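import Mathlib
import Literature.MathematicalPhysics.QuantumFieldTheory.Balaban1983to89.B8
import Literature.MathematicalPhysics.QuantumFieldTheory.Balaban1983to89.B9

/-!
# `Balaban1983to89.B8FromB9` — B8 (1.58)–(1.59) from B9 Theorem 3.3: the curvature transfer, kernel-checked

B8 = T. Balaban, *Spaces of regular gauge field configurations on a lattice and gauge fixing conditions*,
Commun. Math. Phys. **99**, 75–102 (1985) [Balaban1985RegularSpaces]; its reference [4] = B9 = T. Balaban,
*Propagators for lattice gauge theories in a background field*, Commun. Math. Phys. **99**, 389–434 (1985)
[Balaban1985BackgroundPropagators].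

THE STEP UNDER AUDIT (cell census GAPS G-IF-01 (a)/(b), G-B8-06, G-B8-07).  B8 p. 86 [PDF 12], verbatim:
*"They imply finally A = G(U₀)J − G(U₀)D^{η*}_{U₀}D_{U₀}H(U₀)B₁ + H(U₀)B₁ = G(U₀)J + G(U₀)Σ_j Q*_jΛ_j(L^jη)^{−3}B₁,
(1.58) where the operator G(U₀) was introduced and investigated in [4]. Let us recall only the definition:
G(U₀) = (D^{η*}_{U₀}D^η_{U₀} + D^η_{U₀}R(U₀)D^{η*}_{U₀} + Σ_j Q*_jΛ_j(L^jη)^{−2}Q_j)^{−1}.  Theorem 3.3 of [4]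
implies the bounds: |A|_(−1), |∇^η_{U₀}A|_(−2), |D^{η*}_{U₀}D^η_{U₀}A|_(−3), |Δ^η_{U₀}A|_(−3) ≤ B₀(|J|_(−3) + |B₁|)
(1.59)"*.  B9's Theorem 3.3 (p. 399 [PDF 11]) is about *"the operator G(U) (a = 1)"* of (3.27) p. 395:
*"G(U) = G = (Δ_a↾Ω₀)^{−1}"*, *"Δ_a = Δ + DRD* + Q*aQ"* (3.26), where Δ = Δ^η(U) is the covariant LAPLACIAN
of (3.10) p. 392: *"⟨A, ΔA⟩ = ⟨A, D*DA⟩ + ⟨A, Δ′A⟩ … the operator Δ′ will be a bounded, small operator, which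
will be treated as a small perturbation of D*D"*.  B8's operator in (1.58) has D*D where B9 has Δ = D*D + Δ′ —
and B8's choice is FORCED by its own equations ((1.55) D*_{U₀}D_{U₀}A = J, (1.42) R(U₀)D*_{U₀}A = 0,
(1.56) L^jηQ_jA = B₁ on Λ_j): (1.58) is the identity A = G₈(P₈A) for P₈ := D*D + DRD* + Σ_jQ*_jΛ_j(L^jη)^{−2}Q_j
= Δ_a − Δ′ (`b8_158_identity`; the operator H(U₀) of (1.57) cancels and is never needed — census G-IF-01(b)).
So "Theorem 3.3 of [4] implies (1.59)" skips the transfer G = Δ_a^{−1} ↦ G₈ = (Δ_a − Δ′)^{−1} (the two agree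
only at U₀ = 1).  The transfer is a Neumann series — the SAME mechanism B9 prints for another perturbation at
(3.82)–(3.86) pp. 406–407 (*"G(U′U) = Σ_n G(U)(V(A)G(U))^n … convergence in all norms"*) — with the inputs
 (Q2) the γ = −3 global entries (3.47) of Thm 3.3 (`B9.Ineq342_346_347`, `B9.glob_at_minus_three`):
      |GJ|_(−1), |∇_U GJ|_(−2), |Δ_U GJ|_(−3) ≤ B₀|J|_(−3);
 (Q3) B9 (3.69) p. 404 [PDF 16] with U′ = 1, verbatim: *"|(Δ′(U′U)A′)(b)| ≤ O(1)(Mα₀ + α₁)(L^jη)^{−2}|A′|,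
      b ∈ Ω_j (3.69) the supremum on the right-hand side is taken over bonds belonging to one of the plaquettes
      containing the bond b"*, i.e. in the weighted norms (3.41) |Δ′A′|_(−3) ≤ κ|A′|_(−1), κ = O(1)·L·Mα₀.
Both are statements OF THE MANUSCRIPTS UNDER AUDIT and enter below only as displayed hypotheses (`hG`, `hT`,
`hΔ`); nothing internally minted is used as a fact — every declaration of this module is kernel-proved.
Derivation written out in the cell record `b2b-balaban-r1/B8-IF01-transfer.md` (unit r1-g2); this module is its
kernel check (unit b08-g2).

CONTENTS.
* §A  Fixed-point / Neumann algebra on a normed space F: K : F →L[ℝ] F with ‖Kx‖ ≤ θ‖x‖, θ < 1 ⇒ the equation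
      J′ = J + KJ′ has at most one solution, any solution obeys ‖J′‖ ≤ ‖J‖/(1 − θ) (`norm_le_of_fixedPoint`,
      `fixedPoint_unique`), and for complete F the solution exists and is the Neumann series (Σ_n Kⁿ)J = Σ_n KⁿJ
      (`exists_fixedPoint`, `fixedPoint_series`; Mathlib `mul_neg_geom_series`).
* §B  The B8 packaging over two normed spaces E (fields on Ω, norm |·|_(−1)) and F (sources, norm |·|_(−3)):
      P = Δ_a : E →L[ℝ] F with two-sided inverse G (B9's G), Δ′ : E →L[ℝ] F, B8's operator P − Δ′.
      `b8_158_identity` ((1.58) forced, H-free); `b8_G8_existsUnique` (P − Δ′ is invertible: (1.58) uniquely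
      solvable for θ = B₀κ < 1); `b8_159_transfer` (every Thm-3.3 entry T with ‖TJ‖ ≤ B₀|J|_(−3) obeys
      ‖T(PA)‖ ≤ B₀/(1 − θ)·|P₈A|_(−3), where T(PA) = the entry evaluated at A since A = G(PA)); `b8_159_norm_A`;
      `b8_159_printed_shape` / `b8_159_repaired` (the printed form B₀′(|J|_(−3) + |B₁|) with
      B₀′ = B₀max{1, q}/(1 − θ), q = sup_j‖Q*_j‖);
      `b8_159_DstarD_entry` (the third entry of (1.59) is (1.55) itself); `apriori_160_of_transfer` (feeding the
      cell's kernel theorem `B8.apriori_160` BY NAME with B₀ ↦ B₀′).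
* §C  By-name edge from B9's typed Theorem 3.3 block: `opBound_of_B9glob` turns `B9.Ineq342_346_347` (γ = −3,
      via `B9.glob_at_minus_three`; `glob_bound_of_Thm33` from the node `B9.Thm33Printed`) plus a norm DICTIONARY
      into the operator hypothesis `hG`/`hT` of §B; `weighted_369_pointwise` ((Q3) in the weighted norms:
      κ = cLMα₀); and the
      smallness bookkeeping `transfer_constant_le_two` (θ ≤ ½ ⇒ B₀′ ≤ 2B₀max{1,q}), `theta_le_half_iff`
      (θ = B₀cLMα₀ ≤ ½ ⇔ Mα₀ ≤ 1/(2cLB₀): a smallness of α₀ "depending on d and L only", the kind (1.40) imposes).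
* §D  G-B8-07 / C-IF-04 (TN-IF-2): B8 Prop. 6 (1.136) p. 99 in the shape of B9's regularity conditions
      (3.35)–(3.36) p. 396 — B9: *"|A| < O(1)Mα₀(L^jη)^{−1}, |∇^ηA| < O(1)Mα₀(L^jη)^{−2} on □, where O(1)M is a
      size of □ in T_{L^{−j}}"*; B8 p. 98: *"we take a size of □ equal to ML^jη"*, (1.136): *"L^jη|A|, (L^jη)²|∇^ηA|,
      (L^jη)³|∂^{η*}∂^ηA|, (L^jη)³|Δ^ηA| < 7dL²B₁Mα₀ on □_j"* — so B8's bound is (size)·α₀′·(L^jη)^{−n} with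
      α₀′ := 7dL²B₁α₀ (`prop6_in_B9_shape`, from `B8.Prop6Printed` by name; `scaled_lt_iff`; `smallness_conversion`).

Value = kernel-checked interface edge + located gap, NOT summit progress.  Norm caveat (cell DIVERGENCE D-1 /
D-r1.1): the algebra is norm-agnostic; which matrix norm realises |·| is fixed by the instance, not here.
-/

namespace Literature.MathematicalPhysics.QuantumFieldTheory.Balaban1983to89.B8FromB9

/-! ## §A  Fixed-point / Neumann algebra -/

section Neumann

variable {F : Type*} [NormedAddCommGroup F] [NormedSpace ℝ F]

/-- A-priori bound: if ‖Kx‖ ≤ θ‖x‖ with θ < 1, every solution of J′ = J + KJ′ obeys ‖J′‖ ≤ ‖J‖/(1 − θ)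
(B9 (3.86)-type geometric majorisation; r1-g2 record §3 (a)). [folklore] -/
theorem norm_le_of_fixedPoint {K : F →L[ℝ] F} {θ : ℝ} (hK : ∀ x, ‖K x‖ ≤ θ * ‖x‖) (hθ : θ < 1)
    {J J' : F} (h : J' = J + K J') : ‖J'‖ ≤ ‖J‖ / (1 - θ) := by
  rw [le_div_iff₀ (by linarith)]
  have h1 : ‖J'‖ ≤ ‖J‖ + θ * ‖J'‖ :=
    calc ‖J'‖ = ‖J + K J'‖ := by rw [← h]
      _ ≤ ‖J‖ + ‖K J'‖ := norm_add_le _ _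
      _ ≤ ‖J‖ + θ * ‖J'‖ := by linarith [hK J']
  have e : ‖J'‖ * (1 - θ) = ‖J'‖ - θ * ‖J'‖ := by ring
  linarith

/-- Uniqueness: under ‖Kx‖ ≤ θ‖x‖, θ < 1, the equation J′ = J + KJ′ has at most one solution. [folklore] -/
theorem fixedPoint_unique {K : F →L[ℝ] F} {θ : ℝ} (hK : ∀ x, ‖K x‖ ≤ θ * ‖x‖) (hθ : θ < 1)
    {J J₁ J₂ : F} (h₁ : J₁ = J + K J₁) (h₂ : J₂ = J + K J₂) : J₁ = J₂ := by
  have hd : J₁ - J₂ = 0 + K (J₁ - J₂) := by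
    rw [map_sub, zero_add]
    calc J₁ - J₂ = (J + K J₁) - (J + K J₂) := by rw [← h₁, ← h₂]
      _ = K J₁ - K J₂ := by abel
  have h := norm_le_of_fixedPoint hK hθ hd
  rw [norm_zero, zero_div] at h
  exact sub_eq_zero.1 (norm_le_zero_iff.1 h)

/-- The pointwise contraction bound gives the operator-norm bound ‖K‖ ≤ θ < 1. [folklore] -/
theorem opNorm_lt_one {K : F →L[ℝ] F} {θ : ℝ} (hK : ∀ x, ‖K x‖ ≤ θ * ‖x‖) (hθ0 : 0 ≤ θ) (hθ : θ < 1) :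
    ‖K‖ < 1 :=
  (ContinuousLinearMap.opNorm_le_bound K hθ0 hK).trans_lt hθ

/-- Existence (complete F): the NEUMANN SERIES (Σ_n Kⁿ)J solves J′ = J + KJ′ and obeys the a-priori bound —
Mathlib's `mul_neg_geom_series` ((1 − K)Σ_nKⁿ = 1 for ‖K‖ < 1); cf. B9 (3.86) p. 407. [folklore] -/
theorem exists_fixedPoint [CompleteSpace F] {K : F →L[ℝ] F} {θ : ℝ} (hK : ∀ x, ‖K x‖ ≤ θ * ‖x‖)
    (hθ0 : 0 ≤ θ) (hθ : θ < 1) (J : F) :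
    ∃ J' : F, J' = J + K J' ∧ J' = (∑' n : ℕ, K ^ n) J ∧ ‖J'‖ ≤ ‖J‖ / (1 - θ) := by
  have hKn : ‖K‖ < 1 := opNorm_lt_one hK hθ0 hθ
  have h1 : ((1 - K) * ∑' n : ℕ, K ^ n) J = J := by
    rw [mul_neg_geom_series K hKn, one_apply_eq_self]
  rw [mul_apply_eq_comp, sub_apply, one_apply_eq_self] at h1
  have hfix : (∑' n : ℕ, K ^ n) J = J + K ((∑' n : ℕ, K ^ n) J) := sub_eq_iff_eq_add.1 h1
  exact ⟨_, hfix, rfl, norm_le_of_fixedPoint hK hθ hfix⟩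

/-- The Neumann series evaluated termwise: (Σ_n Kⁿ)J = Σ_n (KⁿJ) (= "G₈J = Σ_n Gλ_n, λ_{n+1} = Δ′Gλ_n" of the
r1-g2 record §3 (c), after applying G). [folklore] -/
theorem fixedPoint_series [CompleteSpace F] {K : F →L[ℝ] F} (hKn : ‖K‖ < 1) (J : F) :
    (∑' n : ℕ, K ^ n) J = ∑' n : ℕ, (K ^ n) J := by
  have hs : Summable fun n : ℕ => K ^ n := summable_geometric_of_norm_lt_one hKn
  have h := (ContinuousLinearMap.apply ℝ F J).map_tsum hs
  simpa only [ContinuousLinearMap.apply_apply] using h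

end Neumann

/-! ## §B  The B8 packaging: (1.58) forced, G₈ = (Δ_a − Δ′)⁻¹ exists, (1.59) with repaired constant -/

section Identity158

variable {E F : Type*} [AddCommGroup E] [AddCommGroup F]

/-- **(1.58) is forced, and H(U₀) cancels** (census G-IF-01(b)).  Over bare additive groups: if G inverts
P₈ = D*D + DRD* + W (W = Σ_jQ*_jΛ_j(L^jη)^{−2}Q_j) from the left, then (1.55) D*DA = J, (1.42) RD*A = 0 (so
DRD*A = 0) and (1.56) WA = S (= Σ_jQ*_jΛ_j(L^jη)^{−3}B₁) give A = G(J + S) — the second line of (1.58) — with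
no reference to the operator H(U₀) of (1.57). [cite: Balaban1985RegularSpaces, (1.55)–(1.58) p.86] -/
theorem b8_158_identity (DD DRD W : E →+ F) (G : F → E) (hG : ∀ A, G (DD A + DRD A + W A) = A)
    {A : E} {J S : F} (h55 : DD A = J) (h42 : DRD A = 0) (h56 : W A = S) : A = G (J + S) := by
  calc A = G (DD A + DRD A + W A) := (hG A).symm
    _ = G (J + S) := by rw [h55, h42, h56, add_zero]

end Identity158

section Transfer

variable {E F : Type*} [NormedAddCommGroup E] [NormedSpace ℝ E] [NormedAddCommGroup F] [NormedSpace ℝ F]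

/-- The composite K = Δ′G : F → F is a θ-contraction with θ = B₀κ, from (Q2) ‖GJ‖ ≤ B₀‖J‖ and (Q3)
‖Δ′A′‖ ≤ κ‖A′‖ (r1-g2 record §3 (a): |GΔ′A′|_(−1) ≤ θ|A′|_(−1), here in the transposed order Δ′G on sources).
[folklore] -/
theorem contraction_of_bounds (Δ' : E →L[ℝ] F) (G : F →L[ℝ] E) {B₀ κ : ℝ} (hκ : 0 ≤ κ)
    (hG : ∀ J, ‖G J‖ ≤ B₀ * ‖J‖) (hΔ : ∀ A, ‖Δ' A‖ ≤ κ * ‖A‖) :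
    ∀ x, ‖(Δ'.comp G) x‖ ≤ B₀ * κ * ‖x‖ := fun x =>
  calc ‖(Δ'.comp G) x‖ = ‖Δ' (G x)‖ := rfl
    _ ≤ κ * ‖G x‖ := hΔ (G x)
    _ ≤ κ * (B₀ * ‖x‖) := mul_le_mul_of_nonneg_left (hG x) hκ
    _ = B₀ * κ * ‖x‖ := by ring

/-- **B8's operator G₈ = (Δ_a − Δ′)⁻¹ exists** (census G-IF-01(a), repair): with P = Δ_a : E → F two-sidedly
inverted by B9's G, ‖GJ‖ ≤ B₀‖J‖ (Q2), ‖Δ′A′‖ ≤ κ‖A′‖ (Q3) and θ = B₀κ < 1, the equation (P − Δ′)A = J̃ — i.e.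
(1.58) read as an equation for A — has exactly one solution for every source J̃ (F complete, e.g. finite-
dimensional as in the papers).  The solution is A = GJ′ with J′ = J̃ + Δ′GJ′ the Neumann fixed point. [folklore] -/
theorem b8_G8_existsUnique [CompleteSpace F] (P Δ' : E →L[ℝ] F) (G : F →L[ℝ] E)
    (hGP : ∀ A, G (P A) = A) (hPG : ∀ J, P (G J) = J) {B₀ κ : ℝ} (hB₀ : 0 ≤ B₀) (hκ : 0 ≤ κ)
    (hG : ∀ J, ‖G J‖ ≤ B₀ * ‖J‖) (hΔ : ∀ A, ‖Δ' A‖ ≤ κ * ‖A‖) (hθ : B₀ * κ < 1) (Jt : F) :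
    ∃! A : E, P A - Δ' A = Jt := by
  have hK := contraction_of_bounds Δ' G hκ hG hΔ
  have hθ0 : 0 ≤ B₀ * κ := mul_nonneg hB₀ hκ
  obtain ⟨J', hfix, -, -⟩ := exists_fixedPoint hK hθ0 hθ Jt
  refine ⟨G J', ?_, fun A hA => ?_⟩
  · -- (P − Δ′)(GJ′) = J′ − Δ′GJ′ = J̃
    show P (G J') - (Δ'.comp G) J' = Jt
    rw [hPG]
    exact sub_eq_of_eq_add hfix
  · -- uniqueness: J″ := PA is a fixed point too, hence J″ = J′ and A = GJ″ = GJ′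
    have hfix'' : P A = Jt + (Δ'.comp G) (P A) := by
      show P A = Jt + Δ' (G (P A))
      rw [hGP, ← hA]; abel
    have hJ : P A = J' := fixedPoint_unique hK hθ hfix'' hfix
    rw [← hJ, hGP]

/-- **(1.59) transferred** (census G-IF-01(a), repaired constant B₀/(1 − θ)): let A solve B8's equation
(P − Δ′)A = J̃.  Then J′ := PA is the Neumann fixed point, |J′|_(−3) ≤ |J̃|_(−3)/(1 − θ), and every ENTRY of B9's
Theorem 3.3 — a map T on sources with ‖TJ‖ ≤ B₀|J|_(−3), e.g. T = ∇_U∘G (|∇_UGJ|_(−2)) or Δ_U∘G (|Δ_UGJ|_(−3)),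
(3.47) at γ = −3 — evaluated at J′ (where GJ′ = A, so TJ′ is the entry OF A) is ≤ B₀/(1 − θ)·|J̃|_(−3).
No completeness needed: the solution is given. [folklore] -/
theorem b8_159_transfer (P Δ' : E →L[ℝ] F) (G : F →L[ℝ] E) (hGP : ∀ A, G (P A) = A)
    {B₀ κ : ℝ} (hB₀ : 0 ≤ B₀) (hκ : 0 ≤ κ) (hG : ∀ J, ‖G J‖ ≤ B₀ * ‖J‖) (hΔ : ∀ A, ‖Δ' A‖ ≤ κ * ‖A‖)
    (hθ : B₀ * κ < 1) {X : Type*} [SeminormedAddCommGroup X] (T : F → X) (hT : ∀ J, ‖T J‖ ≤ B₀ * ‖J‖)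
    {A : E} {Jt : F} (hA : P A - Δ' A = Jt) :
    ‖T (P A)‖ ≤ B₀ / (1 - B₀ * κ) * ‖Jt‖ := by
  have hK := contraction_of_bounds Δ' G hκ hG hΔ
  have hfix : P A = Jt + (Δ'.comp G) (P A) := by
    show P A = Jt + Δ' (G (P A))
    rw [hGP, ← hA]; abel
  have hJ' : ‖P A‖ ≤ ‖Jt‖ / (1 - B₀ * κ) := norm_le_of_fixedPoint hK hθ hfix
  calc ‖T (P A)‖ ≤ B₀ * ‖P A‖ := hT (P A)
    _ ≤ B₀ * (‖Jt‖ / (1 - B₀ * κ)) := mul_le_mul_of_nonneg_left hJ' hB₀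
    _ = B₀ / (1 - B₀ * κ) * ‖Jt‖ := by ring

/-- The first entry of (1.59): |A|_(−1) ≤ B₀/(1 − θ)·|J̃|_(−3) (T = G in `b8_159_transfer`, since G(PA) = A). [folklore] -/
theorem b8_159_norm_A (P Δ' : E →L[ℝ] F) (G : F →L[ℝ] E) (hGP : ∀ A, G (P A) = A)
    {B₀ κ : ℝ} (hB₀ : 0 ≤ B₀) (hκ : 0 ≤ κ) (hG : ∀ J, ‖G J‖ ≤ B₀ * ‖J‖) (hΔ : ∀ A, ‖Δ' A‖ ≤ κ * ‖A‖)
    (hθ : B₀ * κ < 1) {A : E} {Jt : F} (hA : P A - Δ' A = Jt) :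
    ‖A‖ ≤ B₀ / (1 - B₀ * κ) * ‖Jt‖ := by
  have h := b8_159_transfer P Δ' G hGP hB₀ hκ hG hΔ hθ G hG hA
  rwa [hGP] at h

omit [NormedSpace ℝ F] in
/-- The source of (1.58): J̃ = J + Q*(weighted B₁) with ‖Q*y‖ ≤ q‖y‖ gives |J̃|_(−3) ≤ |J|_(−3) + q|B₁|
(q = sup_j‖Q_j*‖_{ℓ^∞→ℓ^∞}, a number depending on d, L only; the weights (L^jη)^{−3} are exactly absorbed by
the norm |·|_(−3), B9 (3.41)). [folklore] -/
theorem norm_source_le {Y : Type*} [SeminormedAddCommGroup Y] (Qstar : Y → F) {q : ℝ}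
    (hQ : ∀ y, ‖Qstar y‖ ≤ q * ‖y‖) (J : F) (b : Y) : ‖J + Qstar b‖ ≤ ‖J‖ + q * ‖b‖ :=
  (norm_add_le _ _).trans (by linarith [hQ b])

/-- **(1.59) in its printed shape** with the repaired constant B₀′ = B₀·max{1, q}/(1 − θ): an entry bounded by
B₀/(1 − θ)·|J̃|_(−3) with |J̃|_(−3) ≤ |J|_(−3) + q|B₁| is ≤ B₀′(|J|_(−3) + |B₁|). [folklore] -/
theorem b8_159_printed_shape {B₀ θ q nJ nB nJt x : ℝ} (hB₀ : 0 ≤ B₀) (hθ : θ < 1) (hnJ : 0 ≤ nJ)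
    (hnB : 0 ≤ nB) (hx : x ≤ B₀ / (1 - θ) * nJt) (hJt : nJt ≤ nJ + q * nB) :
    x ≤ B₀ * max 1 q / (1 - θ) * (nJ + nB) := by
  have hc : 0 ≤ B₀ / (1 - θ) := div_nonneg hB₀ (by linarith)
  have h1 : nJ + q * nB ≤ max 1 q * (nJ + nB) := by
    have := le_max_left 1 q
    have := le_max_right 1 q
    nlinarith
  calc x ≤ B₀ / (1 - θ) * nJt := hx
    _ ≤ B₀ / (1 - θ) * (max 1 q * (nJ + nB)) := mul_le_mul_of_nonneg_left (hJt.trans h1) hc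
    _ = B₀ * max 1 q / (1 - θ) * (nJ + nB) := by ring

/-- **Corollary — B8 (1.59) with repaired constant** (census G-IF-01(a)): for A solving B8's equation
(P − Δ′)A = J + Q*b (the identity (1.58), `b8_158_identity`), every Thm-3.3 entry T of A is
≤ B₀max{1, q}/(1 − θ)·(|J|_(−3) + |b|), θ = B₀κ — i.e. (1.59) holds with B8's "B₀" READ AS B₀^{[4]}max{1, q}/(1 − θ)
(≤ 2B₀^{[4]}max{1, q} once θ ≤ ½, `transfer_constant_le_two`). [folklore] -/
theorem b8_159_repaired (P Δ' : E →L[ℝ] F) (G : F →L[ℝ] E) (hGP : ∀ A, G (P A) = A)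
    {B₀ κ q : ℝ} (hB₀ : 0 ≤ B₀) (hκ : 0 ≤ κ) (hG : ∀ J, ‖G J‖ ≤ B₀ * ‖J‖) (hΔ : ∀ A, ‖Δ' A‖ ≤ κ * ‖A‖)
    (hθ : B₀ * κ < 1) {X Y : Type*} [SeminormedAddCommGroup X] [SeminormedAddCommGroup Y]
    (T : F → X) (hT : ∀ J, ‖T J‖ ≤ B₀ * ‖J‖) (Qstar : Y → F) (hQ : ∀ y, ‖Qstar y‖ ≤ q * ‖y‖)
    {A : E} {J : F} {b : Y} (hA : P A - Δ' A = J + Qstar b) :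
    ‖T (P A)‖ ≤ B₀ * max 1 q / (1 - B₀ * κ) * (‖J‖ + ‖b‖) :=
  b8_159_printed_shape hB₀ hθ (norm_nonneg J) (norm_nonneg b)
    (b8_159_transfer P Δ' G hGP hB₀ hκ hG hΔ hθ T hT hA) (norm_source_le Qstar hQ J b)

/-- The third entry of (1.59), |D*_{U₀}D_{U₀}A|_(−3) ≤ B₀′(|J|_(−3) + |B₁|), is (1.55) D*DA = J itself once
B₀′ ≥ 1 (no propagator involved). [cite: Balaban1985RegularSpaces, (1.55) + (1.59) p.86] -/
theorem b8_159_DstarD_entry {B₀' nJ nB j₂ : ℝ} (hB : 1 ≤ B₀') (hnJ : 0 ≤ nJ) (hnB : 0 ≤ nB)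
    (h55 : j₂ = nJ) : j₂ ≤ B₀' * (nJ + nB) := by
  rw [h55]; nlinarith

/-- The repaired constant is at most twice B₀max{1, q} once θ ≤ ½ (r1-g2 record §2: "≤ 2max{1,q}B₀ once
Mα₀ ≤ 1/(2c₁LB₀)"). [folklore] -/
theorem transfer_constant_le_two {B₀ θ q : ℝ} (hB₀ : 0 ≤ B₀) (hθ : θ ≤ 1 / 2) :
    B₀ * max 1 q / (1 - θ) ≤ 2 * (B₀ * max 1 q) := by
  have hm : 0 ≤ B₀ * max 1 q := mul_nonneg hB₀ (le_trans zero_le_one (le_max_left 1 q))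
  rw [div_le_iff₀ (by linarith)]
  nlinarith

/-- θ = B₀·(cLMα₀) ≤ ½ ⇔ Mα₀ ≤ 1/(2cLB₀) for c, L, B₀ > 0: the extra smallness condition of the repair is a
bound on Mα₀ by a constant depending on d, L only — the kind of condition (1.40)/(3.35) already imposes. [folklore] -/
theorem theta_le_half_iff {B₀ c L M α₀ : ℝ} (hB₀ : 0 < B₀) (hc : 0 < c) (hL : 0 < L) :
    B₀ * (c * L * (M * α₀)) ≤ 1 / 2 ↔ M * α₀ ≤ 1 / (2 * c * L * B₀) := by
  have hp : 0 < 2 * c * L * B₀ := by positivity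
  rw [le_div_iff₀ hp]
  constructor <;> intro h <;> nlinarith

/-- **Feeding the cell's (1.60)-theorem by name.**  With the three transferred entries a = |A|_(−1),
g = |∇A|_(−2), l = |Δ_{U₀}A|_(−3) ≤ B₀′(|J|_(−3) + |B₁|) (from `b8_159_transfer` + `b8_159_printed_shape`), the
D*D-entry from (1.55) (`b8_159_DstarD_entry`, B₀′ ≥ 1), and the printed (1.55), (1.56) and side conditions
stated for the REPAIRED constant B₀′, `B8.apriori_160` yields (1.60) with B₀ read as B₀′. [cite: Balaban1985RegularSpaces, (1.55)–(1.60) pp.86–87] -/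
theorem apriori_160_of_transfer {d L C₂ B₀' α₀ α₁ α₂ nJ nB a g j₂ l : ℝ}
    (hd : 0 ≤ d) (hB : 1 ≤ B₀') (hα₂ : 0 ≤ α₂) (hg : 0 ≤ g) (hnJ : 0 ≤ nJ) (hnB : 0 ≤ nB)
    (h55 : nJ ≤ 2 * α₀ + 36 * d * α₂ * g + 50 * d * α₂ ^ 3 + 10 * d * α₀ * α₂)
    (h55eq : j₂ = nJ) (h56 : nB ≤ 2 * d * L * α₁ + C₂ * α₂ ^ 2)
    (h59a : a ≤ B₀' * (nJ + nB)) (h59g : g ≤ B₀' * (nJ + nB)) (h59l : l ≤ B₀' * (nJ + nB))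
    (hside : 36 * d * B₀' * α₂ ≤ 1 / 2) (h50 : 50 * d * α₂ ≤ 1) :
    a ≤ B₀' * (4 * α₀ + 4 * d * L * α₁ + 2 * α₂ ^ 2 + 20 * d * α₀ * α₂ + 2 * C₂ * α₂ ^ 2) ∧
    g ≤ B₀' * (4 * α₀ + 4 * d * L * α₁ + 2 * α₂ ^ 2 + 20 * d * α₀ * α₂ + 2 * C₂ * α₂ ^ 2) ∧
    j₂ ≤ B₀' * (4 * α₀ + 4 * d * L * α₁ + 2 * α₂ ^ 2 + 20 * d * α₀ * α₂ + 2 * C₂ * α₂ ^ 2) ∧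
    l ≤ B₀' * (4 * α₀ + 4 * d * L * α₁ + 2 * α₂ ^ 2 + 20 * d * α₀ * α₂ + 2 * C₂ * α₂ ^ 2) :=
  B8.apriori_160 hd (le_trans zero_le_one hB) hα₂ hg h55 h56 h59a h59g
    (b8_159_DstarD_entry hB hnJ hnB h55eq) h59l hside h50

end Transfer

/-! ## §C  Edge by name from B9's typed Theorem 3.3 -/

section EdgeB9

variable {g : B9.Geometry} {B : B9.Backgrounds}

/-- DICTIONARY edge (census G-B8-06): B9's block (3.42)+(3.46)+(3.47) for the kernel family G (`B9.Thm33Printed`'s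
second family, one configuration U₀, constant B₀) yields the operator hypothesis of §B for the n-th global entry
at γ = −3 — provided the abstract norms ARE the weighted norms: ‖TJ‖ = (3.47)-entry n of GJ at γ = −3 and
‖J‖ = |J|_(−3) (`ι` embeds B8's bond sources J into B9's argument type, "λ replaced by a function J defined at
bonds", Thm 3.3 p. 399).  n = 0: |GJ|_(−1); n = 1: |∇_UGJ|_(−2); n = 3: |Δ_UGJ|_(−3). [folklore] -/
theorem opBound_of_B9glob (GA : B9.KernelFamily g B) {B₀ δ₀ : ℝ} {U : B.Cfg}
    (h33 : B9.Ineq342_346_347 GA B₀ δ₀ U) {F X : Type*} [SeminormedAddCommGroup F] [SeminormedAddCommGroup X]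
    (ι : F → g.Loc) (n : Fin 4) (T : F → X) (hT : ∀ J, ‖T J‖ = GA.glob n U (ι J) (-3))
    (hF : ∀ J, ‖J‖ = g.wNorm (-3) (ι J)) : ∀ J, ‖T J‖ ≤ B₀ * ‖J‖ := fun J => by
  rw [hT, hF]; exact B9.glob_at_minus_three GA h33 n (ι J)

/-- The same edge from the printed THEOREM 3.3 node `B9.Thm33Printed` (its constants M₁, δ₀, a₀, B₀ extracted):
for every member i of the family with M ≥ M₁, every 0 < α₀ with Mα₀ ≤ a₀ and every U satisfying (3.35), the
γ = −3 global entries of the family GA are bounded by B₀|J|_(−3). [folklore] -/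
theorem glob_bound_of_Thm33 {I : Type} {c35 : ℝ} {geo : I → B9.Geometry} {bg : I → B9.Backgrounds}
    {Gp GA : ∀ i, B9.KernelFamily (geo i) (bg i)} (h : B9.Thm33Printed c35 geo bg Gp GA) :
    ∃ M₁ a₀ B₀ : ℝ, 0 < M₁ ∧ 0 < a₀ ∧ 0 < B₀ ∧
      ∀ i : I, M₁ ≤ (geo i).M → ∀ α₀ : ℝ, 0 < α₀ → (geo i).M * α₀ ≤ a₀ →
        ∀ U : (bg i).Cfg, (bg i).Reg335 c35 α₀ U →
          ∀ (n : Fin 4) (lam : (geo i).Loc), (GA i).glob n U lam (-3) ≤ B₀ * (geo i).wNorm (-3) lam := by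
  obtain ⟨M₁, δ₀, a₀, B₀, Bβ, Bε, Bεβ, hM₁, -, ha₀, hB₀, H⟩ := h
  exact ⟨M₁, a₀, B₀, hM₁, ha₀, hB₀, fun i hM α₀ hα hMa U hU n lam =>
    B9.glob_at_minus_three (GA i) (H i hM α₀ hα hMa U hU).2.1 n lam⟩

/-- **(Q3) in weighted form** — the constant κ = c·L·Mα₀ (r1-g2 record §2: "costing at most a factor L^{|γ|} in
the weights").  Pointwise bookkeeping behind |Δ′A′|_(−3) ≤ cLMα₀|A′|_(−1): if at a bond b of scale j
x = |(Δ′A′)(b)| ≤ cMα₀(L^jη)^{−2}·a with a = |A′(b′)| attained at a bond b′ of scale j′ ≥ j − 1 (b′ lies on a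
plaquette containing b, (3.69) p. 404), and (L^{j′}η)·a ≤ N = |A′|_(−1) (the weighted sup norm (3.41) p. 397 /
B8 p. 86: |A|_(α) = sup_j sup_{Ω_j}(L^jη)^{−α}|A|), then (L^jη)³x ≤ cLMα₀·N; taking the sup over b gives the
weighted bound (L ≥ 1). [folklore] -/
theorem weighted_369_pointwise {L η c M α₀ N x a : ℝ} {j j' : ℕ} (hL : 1 ≤ L) (hη : 0 < η)
    (hc : 0 ≤ c * M * α₀) (ha0 : 0 ≤ a)
    (hx : x ≤ c * M * α₀ * ((L ^ j * η) ^ 2)⁻¹ * a) (ha : L ^ j' * η * a ≤ N) (hj : j ≤ j' + 1) :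
    (L ^ j * η) ^ 3 * x ≤ c * L * M * α₀ * N := by
  have hLpos : 0 < L := lt_of_lt_of_le one_pos hL
  have ht : 0 < L ^ j * η := mul_pos (pow_pos hLpos j) hη
  have ht2 : (L ^ j * η) ^ 2 ≠ 0 := pow_ne_zero 2 ht.ne'
  have h1 : (L ^ j * η) ^ 3 * x ≤ c * M * α₀ * (L ^ j * η) * a := by
    have h := mul_le_mul_of_nonneg_left hx (le_of_lt (pow_pos ht 3))
    have e : (L ^ j * η) ^ 3 * (c * M * α₀ * ((L ^ j * η) ^ 2)⁻¹ * a) = c * M * α₀ * (L ^ j * η) * a := by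
      field_simp
    rw [e] at h
    exact h
  have h2 : L ^ j * η * a ≤ L * N := by
    have hpow : L ^ j ≤ L ^ (j' + 1) := pow_le_pow_right₀ hL hj
    calc L ^ j * η * a ≤ L ^ (j' + 1) * η * a :=
          mul_le_mul_of_nonneg_right (mul_le_mul_of_nonneg_right hpow hη.le) ha0
      _ = L * (L ^ j' * η * a) := by ring
      _ ≤ L * N := mul_le_mul_of_nonneg_left ha hLpos.le
  calc (L ^ j * η) ^ 3 * x ≤ c * M * α₀ * (L ^ j * η) * a := h1
    _ = c * M * α₀ * (L ^ j * η * a) := by ring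
    _ ≤ c * M * α₀ * (L * N) := mul_le_mul_of_nonneg_left h2 hc
    _ = c * L * M * α₀ * N := by ring

end EdgeB9

/-! ## §D  B8 Proposition 6 in the shape of B9 (3.35)–(3.36) (census G-B8-07 / C-IF-04, TN-IF-2) -/

section Prop6

/-- **Prop. 6 (1.136) in B9's shape** — by name from `B8.Prop6Printed`: for a cube c of size parameter m = `sizeM c`
(B8 p. 98: "a size of □ equal to ML^jη"; B9 p. 396: "O(1)M is a size of □ in T_{L^{−j}}"), the printed bound
7dL²B₁mα₀ IS m·α₀′ with α₀′ := 7dL²B₁α₀, i.e. the right-hand side of (3.35)–(3.36) with B9's α₀ read as α₀′. [cite: Balaban1985RegularSpaces, Prop. 6 (1.136) p.99] -/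
theorem prop6_in_B9_shape {I : Type} {d : ℕ} {L B₁ c₁ : ℝ} {fam : I → B8.CubeData}
    (P6 : B8.Prop6Printed d L B₁ c₁ fam) (i : I) {α₀ : ℝ} (hα₀ : 0 < α₀) (U₀ : (fam i).Cfg)
    (hU : (fam i).InA α₀ U₀) (c : (fam i).Cube) (hc : 7 * d * L ^ 2 * (fam i).sizeM c * α₀ ≤ c₁) :
    (fam i).GaugedBound U₀ c ((fam i).sizeM c * (7 * d * L ^ 2 * B₁ * α₀)) := by
  have h := P6 i α₀ hα₀ U₀ hU c hc
  have e : 7 * d * L ^ 2 * B₁ * (fam i).sizeM c * α₀ = (fam i).sizeM c * (7 * d * L ^ 2 * B₁ * α₀) := by ring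
  rw [e] at h
  exact h

/-- The scaled form of (1.136), (L^jη)ⁿ|X| < Y, versus B9's form |X| < Y(L^jη)^{−n} of (3.35)–(3.36). [folklore] -/
theorem scaled_lt_iff {t x Y : ℝ} (ht : 0 < t) (n : ℕ) : t ^ n * x < Y ↔ x < Y / t ^ n := by
  rw [lt_div_iff₀ (pow_pos ht n), mul_comm]

/-- B9's smallness hypothesis "Mα₀ ≤ a₀" (Thms 3.1–3.3) for the converted α₀′ = 7dL²B₁α₀ is a condition of the
printed kind 7dL²Mα₀ ≤ c₁ of Prop. 6 (with c₁ ↦ a₀/B₁). [folklore] -/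
theorem smallness_conversion {d L B₁ M α₀ a₀ : ℝ} (hB₁ : 0 < B₁) :
    M * (7 * d * L ^ 2 * B₁ * α₀) ≤ a₀ ↔ 7 * d * L ^ 2 * M * α₀ ≤ a₀ / B₁ := by
  rw [le_div_iff₀ hB₁]
  constructor <;> intro h <;> nlinarith

end Prop6

end Literature.MathematicalPhysics.QuantumFieldTheory.Balaban1983to89.B8FromB9
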